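import Summits.QuantumFields.YangMills.Theorems.UnitScaleTiltFluctuationComparisonRegPrGlobalSlackKernelLegCfgFixedPointFine
import HarnessLib

/-!
# `UnitScaleTiltFluctuationComparisonRegPrGlobalSlackKernelLegCfgFixedPointWitness` — THE FIXED-POINT DISPLAY IS INSTANTIABLE: a configuration family that IS the fixed point
# on the window, from box-preservation and contraction alone (crux `FluctuationComparisonRegPrIntL`, stmt-QuantumFields-20520, skeleton v5kC, STUB 3⁗χ; cell `pub/ym-inputs`,
# seat ym-inputs-p12 = INPUT-LIST I-11 row `CfgDistCauchyΦ`; count-neutral helper, registry untouched)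

WHY.  The fixed-point reading of (R5) / `CfgDistCauchyΦ` (`…KernelLegCfgFixedPoint*`, same seat) asks of the configuration family `B` the display (F) «`B K (K−n) j Y (V↑)` is a
fixed point of run `K`'s map `T K (K−n) j Y (V↑)`» together with the (44) row (S) `CfgDistOwnΦ D B …`.  A DEFINER who has only the MAP `T` (for the minimiser: [Balaban1985Variational]'s
successive approximations) and its two standard properties on the window — (P) `T` maps the (44)-box `{x | ∀ c, ‖x c‖ ≤ C_s(1+d(c))θ(n)x²}` into itself, (C_w) `T` is legwise
`w`-weighted `q`-Lipschitz on it, `0 ≤ q < 1` — gets such a `B` for free: this file produces, by `exists_isFixedPt_of_weighted_contraction` (`…CfgFixedPointFine` §1) and a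
pointwise choice, a family `B : CfgFam 𝕍 F` with (S) AND (F) on the window (off the window `B` is irrelevant to every row).  So the fixed-point display is CONSISTENT and its
(F)+(S) part costs nothing beyond (P)+(C_w); the content of (R5) is then (D)/(M) alone (the two-cut-off defect), as `cfgRefOwnΦ_of_isFixedPt_weight` /
`cfgDistCauchyΦ_of_isFixedPt_twoRun` say.

* **`exists_cfgFam_isFixedPt`** — `∃ B : CfgFam 𝕍 F, CfgDistOwnΦ D B dist b₀ p₀ C_s ∧ (F)` from (P), (C_w) (and the letters `0 ≤ C_s`, `DistNonneg`, window positivity of `θ`,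
  `0 < w`); values in a complete space (`lieC 𝔰𝔲(2)` is finite-dimensional).
HONEST FRAMING.  Bookkeeping over the folklore fixed-point theorem; `T`, `w` free; nothing of [Balaban1985UV3] / [Balaban1985Variational] / [King1986] asserted; not a
discharge of any row; no summit / rung / gap claim (YM₃ on T³ is rung R3, not the Clay problem).

References: T. Bałaban, CMP 102 (1985) 277–309 [Balaban1985Variational] (Thm 1 (8) p.279); CMP 102 (1985) 255–275 [Balaban1985UV3] ((44) p.267); C. King, CMP 102 (1986)
649–677 [King1986] (Prop. 3.9 (3.73)–(3.74) p.665).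
-/

set_option autoImplicit false

noncomputable section

open scoped BigOperators
open Finset
open Literature.MathematicalPhysics.QuantumFieldTheory.Balaban1983to89
open Literature.MathematicalPhysics.QuantumFieldTheory.Balaban1983to89.T3ContinuumYM3Torus
open Literature.MathematicalPhysics.QuantumFieldTheory.Balaban1983to89.T3UnitScaleTilt
open Literature.MathematicalPhysics.QuantumFieldTheory.Balaban1983to89.T3LevelShift
open Literature.MathematicalPhysics.QuantumFieldTheory.Balaban1983to89.T3AlphaInputsAC
open Literature.MathematicalPhysics.QuantumFieldTheory.Balaban1983to89.T3AlphaPolymerSocket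
open Literature.MathematicalPhysics.QuantumFieldTheory.Balaban1983to89.T3AlphaInputsACTwoRun
open Literature.MathematicalPhysics.QuantumFieldTheory.Balaban1983to89.T3AlphaInputsACTwoRunLevel
open Literature.MathematicalPhysics.QuantumFieldTheory.Balaban1985CMP102
open Literature.MathematicalPhysics.QuantumFieldTheory.Balaban1985CMP102.Setting
open Summit.QuantumFields.Balaban3D.Carriers
open Summit.QuantumFields.Balaban3D.Proofs.Primitives
open Summit.QuantumFields.Balaban3D.Proofs.GroupModelLieC (lieC)
open Summit.QuantumFields.YangMills.Theorems
open Summit.QuantumFields.YangMills.Theorems.GlobalSlackKernelMatching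
open Summit.QuantumFields.YangMills.Theorems.GlobalSlackCanonicalPolymers

namespace Summit.QuantumFields.YangMills.Theorems.GlobalSlackKernelLeg

section Witness

variable {𝕍 : Type} [NormedAddCommGroup 𝕍] [NormedSpace ℂ 𝕍] [CompleteSpace 𝕍] {F : T3Family} {γ : ℝ}

omit [NormedSpace ℂ 𝕍] in
/-- **A CONFIGURATION FAMILY THAT IS THE FIXED POINT ON THE WINDOW.**  Given run `K`'s maps `T K k b Y W` and a weight family `w`, suppose on the `θ(n)`-window and the listed domains
(P) `T K (K−n) j Y (V↑)` maps the (44)-box `{x | ∀ c, ‖x c‖ ≤ C_s·(1+d(c))·θ(n)·x²}` into itself and (C_w) is legwise `w`-weighted `q`-Lipschitz on it (`0 < w`, `0 ≤ q < 1`).  Then there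
is `B : CfgFam 𝕍 F` with the (44) row `CfgDistOwnΦ D B dist b₀ p₀ C_s` and the fixed-point display (F) `T K (K−n) j Y (V↑) (B K (K−n) j Y (V↑)) = B K (K−n) j Y (V↑)` on the window
(pointwise: the unique fixed point in the box where one exists, `0` elsewhere). [cite: Balaban1985Variational, Thm 1 (8) p.279; Balaban1985UV3, (44) p.267] -/
theorem exists_cfgFam_isFixedPt {D : AlphaDataT3 F γ} {dist : LegDist F} {b₀ p₀ C_s q : ℝ}
    (T : (K k b : ℕ) → Set (Site (F.P K) 0) → GaugeField (F.P K) k (Matrix.specialUnitaryGroup (Fin 2) ℂ) → (PBond (F.P K) b → 𝕍) → (PBond (F.P K) b → 𝕍))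
    (w : (K k b : ℕ) → Set (Site (F.P K) 0) → GaugeField (F.P K) k (Matrix.specialUnitaryGroup (Fin 2) ℂ) → PBond (F.P K) b → ℝ)
    (hn : DistNonneg dist) (hL : 1 ≤ F.L) (hγ : 0 < γ) (hγ1 : γ ≤ 1) (hb : 0 < b₀) (hCs : 0 ≤ C_s) (hq0 : 0 ≤ q) (hq1 : q < 1)
    (hw : ∀ (K n : ℕ) (h : n ≤ K), ∀ j : ℕ, j < K - n →
      ∀ V : GaugeField (F.P n) 0 (Matrix.specialUnitaryGroup (Fin 2) ℂ), PlaqSmall (θBal F.L γ b₀ p₀ n) V →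
        ∀ Y ∈ D.Loc K (K - n) (D.triv K (K - n)) (1 + j), ∀ c : PBond (F.P K) j, 0 < w K (K - n) j Y (fieldShift (F.sitesPerDir_eq (m := F.m) (K := K) (j := K - n) (m' := F.m) (K' := n) (j' := 0) (by omega)) V) c)
    (hmaps : ∀ (K n : ℕ) (h : n ≤ K), ∀ j : ℕ, j < K - n →
      ∀ V : GaugeField (F.P n) 0 (Matrix.specialUnitaryGroup (Fin 2) ℂ), PlaqSmall (θBal F.L γ b₀ p₀ n) V →
        ∀ Y ∈ D.Loc K (K - n) (D.triv K (K - n)) (1 + j), ∀ x : PBond (F.P K) j → 𝕍,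
          (∀ c, ‖x c‖ ≤ C_s * (1 + dist K j Y c) * θBal F.L γ b₀ p₀ n * (((F.L : ℝ) ^ (K - n - 1 - j))⁻¹) ^ 2) →
            ∀ c, ‖T K (K - n) j Y (fieldShift (F.sitesPerDir_eq (m := F.m) (K := K) (j := K - n) (m' := F.m) (K' := n) (j' := 0) (by omega)) V) x c‖ ≤ C_s * (1 + dist K j Y c) * θBal F.L γ b₀ p₀ n * (((F.L : ℝ) ^ (K - n - 1 - j))⁻¹) ^ 2)
    (hlip : ∀ (K n : ℕ) (h : n ≤ K), ∀ j : ℕ, j < K - n →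
      ∀ V : GaugeField (F.P n) 0 (Matrix.specialUnitaryGroup (Fin 2) ℂ), PlaqSmall (θBal F.L γ b₀ p₀ n) V →
        ∀ Y ∈ D.Loc K (K - n) (D.triv K (K - n)) (1 + j), ∀ x y : PBond (F.P K) j → 𝕍,
          (∀ c, ‖x c‖ ≤ C_s * (1 + dist K j Y c) * θBal F.L γ b₀ p₀ n * (((F.L : ℝ) ^ (K - n - 1 - j))⁻¹) ^ 2) →
          (∀ c, ‖y c‖ ≤ C_s * (1 + dist K j Y c) * θBal F.L γ b₀ p₀ n * (((F.L : ℝ) ^ (K - n - 1 - j))⁻¹) ^ 2) →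
            ∀ M : ℝ, 0 ≤ M → (∀ c, ‖x c - y c‖ ≤ M * w K (K - n) j Y (fieldShift (F.sitesPerDir_eq (m := F.m) (K := K) (j := K - n) (m' := F.m) (K' := n) (j' := 0) (by omega)) V) c) →
              ∀ c, ‖T K (K - n) j Y (fieldShift (F.sitesPerDir_eq (m := F.m) (K := K) (j := K - n) (m' := F.m) (K' := n) (j' := 0) (by omega)) V) x c - T K (K - n) j Y (fieldShift (F.sitesPerDir_eq (m := F.m) (K := K) (j := K - n) (m' := F.m) (K' := n) (j' := 0) (by omega)) V) y c‖ ≤ q * M * w K (K - n) j Y (fieldShift (F.sitesPerDir_eq (m := F.m) (K := K) (j := K - n) (m' := F.m) (K' := n) (j' := 0) (by omega)) V) c) :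
    ∃ B : CfgFam 𝕍 F, CfgDistOwnΦ D B dist b₀ p₀ C_s ∧
      ∀ (K n : ℕ) (h : n ≤ K), ∀ j : ℕ, j < K - n →
        ∀ V : GaugeField (F.P n) 0 (Matrix.specialUnitaryGroup (Fin 2) ℂ), PlaqSmall (θBal F.L γ b₀ p₀ n) V →
          ∀ Y ∈ D.Loc K (K - n) (D.triv K (K - n)) (1 + j),
            T K (K - n) j Y (fieldShift (F.sitesPerDir_eq (m := F.m) (K := K) (j := K - n) (m' := F.m) (K' := n) (j' := 0) (by omega)) V) (B K (K - n) j Y (fieldShift (F.sitesPerDir_eq (m := F.m) (K := K) (j := K - n) (m' := F.m) (K' := n) (j' := 0) (by omega)) V)) = B K (K - n) j Y (fieldShift (F.sitesPerDir_eq (m := F.m) (K := K) (j := K - n) (m' := F.m) (K' := n) (j' := 0) (by omega)) V) := by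
  classical
  -- the (44)-box radius as a function of run `K`'s own indices `(k, b, Y)`: height `K − k`, level factor `L^{−2(k−1−b)}`
  let ρ : (K k b : ℕ) → Set (Site (F.P K) 0) → PBond (F.P K) b → ℝ := fun K k b Y c =>
    C_s * (1 + dist K b Y c) * θBal F.L γ b₀ p₀ (K - k) * (((F.L : ℝ) ^ (k - 1 - b))⁻¹) ^ 2
  -- the pointwise property «fixed point of `T K k b Y W` in the box»
  let P : (K k b : ℕ) → Set (Site (F.P K) 0) → GaugeField (F.P K) k (Matrix.specialUnitaryGroup (Fin 2) ℂ) → (PBond (F.P K) b → 𝕍) → Prop :=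
    fun K k b Y W x => (∀ c, ‖x c‖ ≤ ρ K k b Y c) ∧ T K k b Y W x = x
  refine ⟨fun K k b Y W => if h : ∃ x, P K k b Y W x then h.choose else 0, ?_, ?_⟩
  · -- (44): on the window the chosen value is a fixed point IN THE BOX
    intro K n hnK j hj V hV Y hY c
    have hθ : 0 ≤ θBal F.L γ b₀ p₀ n := (T3MinimiserStabilityReduction.θBal_pos hL hγ hγ1 hb p₀ n).le
    have hKn : K - (K - n) = n := by omega
    have hex : ∃ x, P K (K - n) j Y (fieldShift (F.sitesPerDir_eq (m := F.m) (K := K) (j := K - n) (m' := F.m) (K' := n) (j' := 0) (by omega)) V) x := by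
      obtain ⟨x, hxbox, hTx, -⟩ := exists_isFixedPt_of_weighted_contraction (fun c => w K (K - n) j Y (fieldShift (F.sitesPerDir_eq (m := F.m) (K := K) (j := K - n) (m' := F.m) (K' := n) (j' := 0) (by omega)) V) c)
        (fun c => hw K n hnK j hj V hV Y hY c) (fun c => ρ K (K - n) j Y c) (T K (K - n) j Y (fieldShift (F.sitesPerDir_eq (m := F.m) (K := K) (j := K - n) (m' := F.m) (K' := n) (j' := 0) (by omega)) V)) hq0 hq1 0
        (fun c => by
          simp only [Pi.zero_apply, norm_zero, ρ, hKn]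
          have := hn K j Y c
          positivity)
        (fun x hx => by simpa only [ρ, hKn] using hmaps K n hnK j hj V hV Y hY x (by simpa only [ρ, hKn] using hx))
        (fun x y hx hy M hM hxy => hlip K n hnK j hj V hV Y hY x y (by simpa only [ρ, hKn] using hx) (by simpa only [ρ, hKn] using hy) M hM hxy)
      exact ⟨x, hxbox, hTx⟩
    have hval : (fun K k b Y W => if h : ∃ x, P K k b Y W x then h.choose else (0 : PBond (F.P K) b → 𝕍)) K (K - n) j Y (fieldShift (F.sitesPerDir_eq (m := F.m) (K := K) (j := K - n) (m' := F.m) (K' := n) (j' := 0) (by omega)) V) = hex.choose := by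
      simp only [dif_pos hex]
    rw [hval]
    have hspec := hex.choose_spec.1 c
    simpa only [ρ, hKn] using hspec
  · -- (F): the chosen value is a fixed point
    intro K n hnK j hj V hV Y hY
    have hKn : K - (K - n) = n := by omega
    have hex : ∃ x, P K (K - n) j Y (fieldShift (F.sitesPerDir_eq (m := F.m) (K := K) (j := K - n) (m' := F.m) (K' := n) (j' := 0) (by omega)) V) x := by
      obtain ⟨x, hxbox, hTx, -⟩ := exists_isFixedPt_of_weighted_contraction (fun c => w K (K - n) j Y (fieldShift (F.sitesPerDir_eq (m := F.m) (K := K) (j := K - n) (m' := F.m) (K' := n) (j' := 0) (by omega)) V) c)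
        (fun c => hw K n hnK j hj V hV Y hY c) (fun c => ρ K (K - n) j Y c) (T K (K - n) j Y (fieldShift (F.sitesPerDir_eq (m := F.m) (K := K) (j := K - n) (m' := F.m) (K' := n) (j' := 0) (by omega)) V)) hq0 hq1 0
        (fun c => by
          simp only [Pi.zero_apply, norm_zero, ρ, hKn]
          have hθ : 0 ≤ θBal F.L γ b₀ p₀ n := (T3MinimiserStabilityReduction.θBal_pos hL hγ hγ1 hb p₀ n).le
          have := hn K j Y c
          positivity)
        (fun x hx => by simpa only [ρ, hKn] using hmaps K n hnK j hj V hV Y hY x (by simpa only [ρ, hKn] using hx))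
        (fun x y hx hy M hM hxy => hlip K n hnK j hj V hV Y hY x y (by simpa only [ρ, hKn] using hx) (by simpa only [ρ, hKn] using hy) M hM hxy)
      exact ⟨x, hxbox, hTx⟩
    have hval : (fun K k b Y W => if h : ∃ x, P K k b Y W x then h.choose else (0 : PBond (F.P K) b → 𝕍)) K (K - n) j Y (fieldShift (F.sitesPerDir_eq (m := F.m) (K := K) (j := K - n) (m' := F.m) (K' := n) (j' := 0) (by omega)) V) = hex.choose := by
      simp only [dif_pos hex]
    rw [hval]
    exact hex.choose_spec.2

end Witness

end Summit.QuantumFields.YangMills.Theorems.GlobalSlackKernelLeg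

end
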